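import Summits.ABC.StewartYu.PadicTwoAssembly
import Summits.ABC.StewartYu.PadicTwoEngine
import HarnessLib

/-!
# Cell abc-stewartyu, W80Two (ix): packs ⇒ the core bound ⇒ the engine, for the `2`-adic machine

`Summits/ABC/StewartYu/PadicTwoFinal.lean` — cell `abc-stewartyu` (seat p3; route `PadicPrimesW80TwoThirds`,
crux `W80Two` stmt-ABC-19486; theorems only, no named fact).  The `p = 2` twin of p2's
`PadicTwistFinal.lean` up to the existence of packs: `twoCoreBound_of_packs` (p2-g3's parameter packs
`TwoSetup.ParamPack3` for `d ≥ 1` at the exponent `C(d+1)·(∏ Vⱼ·V_θ)·(W + log 2Vmax)·log 2Vmax`, plus the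
`d = 0` Liouville case `TwoSetup.coreBound_of_d_zero`, give `TwoSetup.TwoCoreBound C`) and
`engineTwoW80_of_packs` (the same packs with an admissible constant `2 ≤ C m ≤ c₁^m m^m`, `3 ≤ C 1`, give
the engine text of `TwoSetup.engineTwoW80_of_coreBound` — lit's `hE` of `two_of_w80Engine` with the
integrality binder).  The existence of the packs on p1's `q = 3` record (`packs_exist_two`) is the sequel
`PadicTwoPack.lean`.  Everything is [folklore] in the architecture of [Yu1990, Theorem 2.1] /
[Waldschmidt1980, Prop. 3.8].

## References
* [Yu1989] K. Yu, Acta Arith. 53 (1989), §3.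
* [Yu1990] K. Yu, Compositio Math. 74 (1990), Theorem 2.1 and Proposition 2.1.
* [Waldschmidt1980] M. Waldschmidt, Acta Arith. 37 (1980), Prop. 3.8 (p. 263).
-/

noncomputable section

open Finset Height
open Literature.NumberTheory.Transcendental

namespace Summit.ABC.StewartYu

namespace TwoSetup

/-- **Packs `ParamPack3` for every `2`-adic set-up with `d ≥ 1` give the core bound** (the case `d = 0`
by Liouville, for `3 ≤ C 1`). [cite: Yu1990, Proposition 2.1] [cite: Waldschmidt1980, Prop. 3.8] -/
theorem twoCoreBound_of_packs {C : ℕ → ℝ} (hC1 : 3 ≤ C 1)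
    (hpk : ∀ (S : TwoSetup) (V : Fin S.d → ℝ) (Vθ Vmax W : ℝ), 1 ≤ S.d →
      (∀ i, ∃ a : ℤ, S.toQ.all i = a) →
      (∀ κ : Fin (S.d + 1) → ℕ, (∃ j, ¬ 3 ∣ κ j) → ∀ γ : ℚ, ∏ j, S.toQ.all j ^ κ j ≠ γ ^ 3) →
      (∀ μ : Fin (S.d + 1) → ℤ, ∏ i, S.toQ.all i ^ μ i = 1 → μ = 0) →
      (∀ j, logHeight₁ (S.α j) ≤ V j) → logHeight₁ S.θ ≤ Vθ →
      (∀ j, 1 ≤ V j) → 1 ≤ Vθ → (∀ j, V j ≤ Vmax) → Vθ ≤ Vmax →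
      (∀ j, Real.log (max 3 (|S.b j| : ℝ)) ≤ W) → Real.log (max 3 (|S.bθ| : ℝ)) ≤ W → 1 ≤ W →
      Nonempty (S.ParamPack3
        (C (S.d + 1) * ((∏ j, V j) * Vθ) * (W + Real.log (2 * Vmax)) * Real.log (2 * Vmax)))) :
    TwoCoreBound C := by
  intro S V Vθ Vmax W hint hK hμ hV hVθ hV1 hVθ1 hVm hVθm hW hWθ hW1
  rcases Nat.eq_zero_or_pos S.d with hd | hd
  · exact S.coreBound_of_d_zero hd hC1 V Vθ Vmax W hVθ hVθ1 hVθm hW1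
  · obtain ⟨pk⟩ := hpk S V Vθ Vmax W hd hint hK hμ hV hVθ hV1 hVθ1 hVm hVθm hW hWθ hW1
    exact not_le.mp (S.not_norm_Λ₀_le_of_paramPack3 pk)

/-- **From packs at an admissible constant to the engine text**: `3 ≤ C 1`, `2 ≤ C m ≤ c₁^m m^m`
(`m ≥ 1`) and packs as in `twoCoreBound_of_packs` give the Waldschmidt-shape `2`-adic engine for integer
generators `≡ 1 (mod 8)` (`engineTwoW80_of_coreBound`). [folklore] -/
theorem engineTwoW80_of_packs {C : ℕ → ℝ} {c₁ : ℝ} (hc₁ : 1 ≤ c₁) (hC1 : 3 ≤ C 1)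
    (hC2 : ∀ m, 1 ≤ m → 2 ≤ C m) (henv : ∀ m, 1 ≤ m → C m ≤ c₁ ^ m * (m : ℝ) ^ m)
    (hpk : ∀ (S : TwoSetup) (V : Fin S.d → ℝ) (Vθ Vmax W : ℝ), 1 ≤ S.d →
      (∀ i, ∃ a : ℤ, S.toQ.all i = a) →
      (∀ κ : Fin (S.d + 1) → ℕ, (∃ j, ¬ 3 ∣ κ j) → ∀ γ : ℚ, ∏ j, S.toQ.all j ^ κ j ≠ γ ^ 3) →
      (∀ μ : Fin (S.d + 1) → ℤ, ∏ i, S.toQ.all i ^ μ i = 1 → μ = 0) →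
      (∀ j, logHeight₁ (S.α j) ≤ V j) → logHeight₁ S.θ ≤ Vθ →
      (∀ j, 1 ≤ V j) → 1 ≤ Vθ → (∀ j, V j ≤ Vmax) → Vθ ≤ Vmax →
      (∀ j, Real.log (max 3 (|S.b j| : ℝ)) ≤ W) → Real.log (max 3 (|S.bθ| : ℝ)) ≤ W → 1 ≤ W →
      Nonempty (S.ParamPack3
        (C (S.d + 1) * ((∏ j, V j) * Vθ) * (W + Real.log (2 * Vmax)) * Real.log (2 * Vmax)))) :
    ∃ (C : ℕ → ℝ) (c₁ : ℝ), 1 ≤ c₁ ∧ (∀ m, 0 ≤ C m ∧ C m ≤ c₁ ^ m * (m : ℝ) ^ m) ∧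
      ∀ (m : ℕ) (α : Fin m → ℚ) (b : Fin m → ℤ) (V : Fin m → ℝ) (Vmax W : ℝ),
        (∀ j, 3 ≤ padicValRat 2 (α j - 1)) →
        (∀ j, ∃ a : ℤ, α j = a) →
        (∀ μ : Fin m → ℤ, ∏ j, α j ^ μ j = 1 → μ = 0) →
        (∀ κ : Fin m → ℕ, (∃ j, ¬ 3 ∣ κ j) → ∀ γ : ℚ, ∏ j, α j ^ κ j ≠ γ ^ 3) →
        (∀ j, Height.logHeight₁ (α j) ≤ V j) → (∀ j, 1 ≤ V j) → (∀ j, V j ≤ Vmax) →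
        b ≠ 0 → (∀ j, Real.log (max 3 (|b j| : ℝ)) ≤ W) → 1 ≤ W →
        (padicValRat 2 (∏ j, α j ^ b j - 1) : ℝ) ≤
          C m * (∏ j, V j) * (W + Real.log (2 * Vmax)) * Real.log (2 * Vmax) :=
  engineTwoW80_of_coreBound hc₁ hC2 henv (twoCoreBound_of_packs hC1 hpk)

end TwoSetup

end Summit.ABC.StewartYu

end
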